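import Literature.MathematicalPhysics.QuantumFieldTheory.Balaban1983to89.B9Eq315QTowerRegularityProfile

/-!
# `Balaban1983to89.B9Eq315QTowerRegularityDisplay` — T. Bałaban, *Averaging operations for lattice gauge theories*, Commun. Math. Phys. **98** (1985)
# 17–51 [Balaban1985Averaging] Proposition 2 (52)–(54) p. 26 with the LEVEL-WISE inequality (53) p. 26 and p. 37 (after (127)), read on the tower of
# [Balaban1985BackgroundPropagators] (3.15) p. 393: **THE PLAQUETTE PROFILE OF THE LEVEL BACKGROUNDS AND THE REGULARITY DISPLAY OF `Q_k(U)` READ OFF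
# (52)** — (a) `pdev(Ū^{k−1−n}) < 2α₀·(L^{−2})^{n+1}` at every depth `n < k`; (b) ONE display function `α : ℕ → ℝ` serving `B9Eq315QTower.QkOfU`'s
# `hα1`∕`hreg` at EVERY depth AND the geometric profile `α_n ≤ 32(d+1)(d+4)α₀·(L^{−2})^n` on the levels — the junction that feeds
# `B9Eq315QTowerLipschitzProfile` §4 (`hαg` restricted to `j < k`) from `B9Eq315QTowerRegularityProfile.ulev_reg_geometric`

statement-level skeleton of published theorems with citation tags; proofs where landed; nothing here is a claim about the Yang–Mills mass gap

PDF held: `paper:balaban1985-cmp98-averaging` (journal page = PDF page + 16) pp. 25–26, 37 — through the verbatim quotations of the tree's `B7Prop2Explicit`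
(§3 (52)–(54)), `B7Eq123General` (`level_data`, `blockLoops_of_pdev`), `B11Eq44COperatorTower` and `B9Eq315QTowerRegularityProfile`;
[Balaban1985BackgroundPropagators] p. 393 (3.15) and p. 396 (3.35) read by this seat (2026-08-22) in the held text layer (p0005, p0008).
THE PRINT (verbatim).  [B7] (53) p. 26: *«sup_{p⊂Ω^{(j)}} |Ū^j(∂p) − 1| < α₀(L^jη)² + C₀(α₀(L^jη)²)²·[1 + L^{−2}(1+C₀α₀)² + … + (L^{−2}(1+C₀α₀)²)^{j−1}]»*;
p. 37 (after (127)): *«Then by this proposition the configurations Ū₀ʲ for j < k satisfy the assumptions of Proposition 3 for V₀ = Ū₀ʲ if α₀L^{2j}η² +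
2C₀(α₀L^{2j}η²)² ≦ 2α₀L^{2j}η² < α₀ ≦ c₃»*; p. 25 (before (47)): *«|V₀(Γ_{c,x}) − 1| < |Γ_{c,x}|dLα₀ < (2d+1)LdLα₀ = O(1)L²α₀»*.

WHY THIS FILE (cell context; OFFER O-ne9leaf02-g64-1 of the pub-balaban NE9 crux team, «SEQUEL» = GO by the row OWNER t4-ne9-p1 gen 84).  The owner's
`B9Eq315QTowerRegularityProfile.ulev_reg_geometric` derives from (52) the GEOMETRIC block-loop profile `α_n ≤ α⋆r^n` (`α⋆ = 32(d+1)(d+4)α₀`,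
`r = L^{−2}`) at every COMPOSED depth `n < k`; its `exists_reg_profile_geometric` packages `(α⋆, r)` and that bound.  A consumer of
`B9Eq315QTowerLipschitzProfile.norm_QkW_sub_flat_le_geometric` needs more: ONE display `α : ℕ → ℝ` with `α n ≤ 1∕64` and the `hreg` display of `QkOfU`
at EVERY depth `n : ℕ` — including the junk depths `n ≥ k`, where `UlevOf L m k U n` is the background `U` itself read on a finer-period torus
(`B11Eq44COperatorTower.perCfg_UlevOf_of_le`), NOT geometrically small, and served by ne9-leaf-03's depth-uniform `αT = 32(d+1)(d+4)L²α₀`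
(`ulev_reg_of_pdev`) — together with the profile inequality on the levels `n < k` ONLY (the restricted `hαg` of the profile file's v1.1).  THIS FILE is
that junction, plus the level-wise (53) itself on the depth index (the plaquette profile before the loop reading), which the owner's file uses but
does not state.

WHAT IS PROVED (sorry-free; proof lane — no `def`, no `Prop` placeholder, no inequality of the papers asserted hypothesis-free; (52) ⇒ (53) ⇒ block loops
is the crews' `level_data` ∕ `blockLoops_of_pdev` and the owner's `ulev_reg_geometric`, instantiated).
* §1 **`ulev_pdev_lt_of_pdev`** — THE LEVEL-WISE (53)∕p. 37 ON THE TOWER's DEPTH INDEX: under (52), at every depth `n < k` the level background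
  `Ū^{k−1−n}` (extended to `ℤ^d`, `perCfg_UlevOf`) has `pdev < 2α₀·(L^{−2})^{n+1}` (print's `2α₀L^{2j}η²`, `η = L^{−k}`, `j = k − 1 − n`) and is `U1`-valued.
* §2 `profile_le_αT` — the profile value `32(d+1)(d+4)α₀·(L^{−2})^n` is below leaf-03's uniform `αT` (hence `≤ 1∕64` under `4α₀ ≤ c₂′`).
* §3 **`exists_reg_profile_of_pdev`** — THE CONSUMER's SHAPE: `∃ α : ℕ → ℝ, (∀ n, 0 ≤ α n) ∧ (∀ n, α n ≤ 1∕64) ∧ (hreg display of QkOfU at every depth) ∧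
  (∀ n < k, α n ≤ 32(d+1)(d+4)α₀·((L²)⁻¹)^n)` — `obtain ⟨α, hα0, hα1, hreg, hαg⟩ := …` then `norm_QkW_sub_flat_le_geometric` at
  `(α, hα1, ulev_mem_U1_of_pdev, hreg)` with `αs := 32(d+1)(d+4)α₀`, `r := (L²)⁻¹` (`0 ≤ r < 1` by the owner's `exists_reg_profile_geometric` or directly).
MODEL ∕ DECLARED READINGS.  (M1) those of `B9Eq315QTower` ∕ `B11Eq44COperatorTower` (M2-k) ∕ `B9Eq315QTowerRegularityProfile`: ONE background `U` on
the finest torus `T_{L^k m}` valued in an averaging-closed `G ⊂ U1`, (52) `pdev(perCfg U) < α₀L^{−2k}`, `C₀α₀ ≤ 1∕3`, `4α₀ ≤ c₂′(d,L)`, `L ≥ 2`;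
(M2) small field everywhere (one domain); (M3) depth `n = 0` = the coarsest factor `Q(Ū^{k−1})`.
HONEST SCOPE.  [folklore] instantiation + an `if n + 1 ≤ k then … else αT` display; the `ε`-profile (bond smallness of `Ū^j`) is NOT derivable gauge-free
and stays displayed in the profile file; nothing of [B9] Lemma 3.1 ∕ (3.37); NOT summit progress (cell pub-balaban: NE9 NOT PRINTED ∕ NOT PROVED, «NE9 ⇐ the
named binders»; row WALLED ON A MODEL; spine PROVED 0∕9; rung (B)+1 finite T⁴ — NOT infinite volume, NOT mass gap, NOT Clay; HONEST DEPENDENCY: continuum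
YM on T⁴ ⇐ BetaPertH ∧ nine spine estimates (0/9 proved); BetaPertH ⇐ (D1) ∧ (D4) ∧ CAP+tail; G-an2-4 gates asym, D1 and NE2/3/4).  Filed by the NE9
crux-team leaf seat `b2b-balaban-t4-ne9-formalise-leaf-02` (gen 64); NEW file importing `B9Eq315QTowerRegularityProfile` only; nothing of the owner's ∕
leaf-03's files modified or restated.  Net new unproved facts: 0.
-/

noncomputable section

namespace Literature.MathematicalPhysics.QuantumFieldTheory.Balaban1983to89.B9Eq315QTowerRegularityDisplay

open B9Eq315QTorus (perSite perCfg perCfg_apply cornerSite)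
open B9Eq315QTower (towerP towerP_apply UlevOf perCfg_UlevOf)
open B9SectCLatticeCarrier (Bond)
open B4Sect5Torus (TSite)
open B7Prop1Explicit (U1 Wcx boxVec)
open B7Prop2Explicit (pdev AvgClosed C0 c2' avgIter)
open B7Eq123General (level_data)
open B11Eq44COperatorTower (αT αT_le ulev_reg_of_pdev)
open B9Eq315QTowerRegularityProfile (ulev_reg_geometric)

variable {d : ℕ} {𝔸 : Type*} [NormedRing 𝔸] [NormedAlgebra ℂ 𝔸] [CompleteSpace 𝔸] [NormOneClass 𝔸]
  (L : ℕ) [NeZero L] (m : Fin d → ℕ) [∀ i, NeZero (m i)] (k : ℕ) (U : Bond d (towerP L m k) → 𝔸ˣ)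
  (hL : 2 ≤ L) {G : Subgroup 𝔸ˣ} (hG : AvgClosed d L G)
  (hU : ∀ (x : B7Prop1Explicit.Site d) (κ : Fin d), perCfg (towerP L m k) U x κ ∈ G) {α₀ : ℝ} (hα : 0 < α₀)
  (hα3 : C0 d * α₀ ≤ 1 / 3) (hα4 : 4 * α₀ ≤ c2' d L) (h52 : pdev (perCfg (towerP L m k) U) < α₀ * (((L : ℝ) ^ k)⁻¹) ^ 2)

/-! ## §1 The level-wise (53) on the tower's depth index: `pdev(Ū^{k−1−n}) < 2α₀·(L^{−2})^{n+1}` -/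

omit [NeZero L] in
/-- the depth arithmetic: `(L^{k−1−n} · (L^k)⁻¹)² = (L^{−2})^{n+1}` for `n + 1 ≤ k` (level `j = k − 1 − n` has `L^jη = L^{−(n+1)}`, `η = L^{−k}`). [folklore] -/
private theorem ratio_sq_eq (hL1 : 1 ≤ L) {n : ℕ} (hn : n + 1 ≤ k) :
    ((L : ℝ) ^ (k - 1 - n) * ((L : ℝ) ^ k)⁻¹) ^ 2 = (((L : ℝ) ^ 2)⁻¹) ^ (n + 1) := by
  have hL0 : (0 : ℝ) < L := by exact_mod_cast hL1
  have hk : (L : ℝ) ^ k = (L : ℝ) ^ (k - 1 - n) * (L : ℝ) ^ (n + 1) := by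
    rw [← pow_add]; congr 1; omega
  have hq : (L : ℝ) ^ (k - 1 - n) * ((L : ℝ) ^ k)⁻¹ = ((L : ℝ) ^ (n + 1))⁻¹ := by
    rw [hk, mul_inv, ← mul_assoc, mul_inv_cancel₀ (pow_ne_zero _ hL0.ne'), one_mul]
  rw [hq, inv_pow, inv_pow, ← pow_mul, ← pow_mul, mul_comm]

include hL hG hU hα hα3 hα4 h52 in
/-- **THE LEVEL-WISE (53) ∕ p. 37 ON THE TOWER**: under (52) on the finest torus, the level background at depth `n < k` — `Ū^{k−1−n}` extended to `ℤ^d`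
(`perCfg_UlevOf`) — has plaquette deviation `< 2α₀·(L^{−2})^{n+1}` (print's «≦ 2α₀L^{2j}η²», `j = k − 1 − n`), and is `U1`-valued (the crews'
`B7Eq123General.level_data` at `j = k − 1 − n`). [cite: Balaban1985Averaging, (53) p.26, p.37 (after (127)), Proposition 2 (52)–(54) p.26; Balaban1985BackgroundPropagators, (3.15) p.393] -/
theorem ulev_pdev_lt_of_pdev {n : ℕ} (hn : n + 1 ≤ k) :
    pdev (perCfg (towerP L m (n + 1)) (UlevOf L m k U n)) < 2 * α₀ * (((L : ℝ) ^ 2)⁻¹) ^ (n + 1) ∧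
      ∀ (x : B7Prop1Explicit.Site d) (κ : Fin d), perCfg (towerP L m (n + 1)) (UlevOf L m k U n) x κ ∈ U1 𝔸 := by
  have hL1 : 1 ≤ L := le_trans (by norm_num) hL
  obtain ⟨hV1, -, hβ, -⟩ := level_data L hL hG k _ hU hα hα3 hα4 h52 (k - 1 - n) (by omega)
  rw [perCfg_UlevOf L m hn U]
  refine ⟨hβ.trans_eq ?_, hV1⟩
  rw [ratio_sq_eq L k hL1 hn]; ring

/-! ## §2 The profile value is below leaf-03's uniform `αT` -/

omit [NeZero L] in
include hL hα in
/-- `32(d+1)(d+4)α₀·(L^{−2})^n ≤ αT = 32(d+1)(d+4)L²α₀` (`L ≥ 2`, `α₀ > 0`): every consumer of `ulev_reg_of_pdev` is served by the profile too.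
[cite: Balaban1985Averaging, (53)–(54) p.26] -/
theorem profile_le_αT (n : ℕ) : 32 * ((d : ℝ) + 1) * ((d : ℝ) + 4) * α₀ * (((L : ℝ) ^ 2)⁻¹) ^ n ≤ αT d L α₀ := by
  have hL1 : (1 : ℝ) ≤ L := by exact_mod_cast le_trans (by norm_num) hL
  have hL2 : (1 : ℝ) ≤ (L : ℝ) ^ 2 := one_le_pow₀ hL1
  have hr1 : (((L : ℝ) ^ 2)⁻¹) ^ n ≤ 1 := pow_le_one₀ (by positivity) (inv_le_one_of_one_le₀ hL2)
  have hA : 0 ≤ 32 * ((d : ℝ) + 1) * ((d : ℝ) + 4) * α₀ := by positivity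
  unfold αT
  nlinarith [mul_le_mul_of_nonneg_left hr1 hA, mul_le_mul_of_nonneg_left hL2 hA]

/-! ## §3 The consumer's shape: one display function with the `hreg` display at every depth and the geometric profile on the levels -/

include hL hG hU hα hα3 hα4 h52 in
/-- **THE REGULARITY DISPLAY OF `Q_k(U)` READ OFF (52), WITH ITS GEOMETRIC PROFILE ON THE LEVELS** — the shape consumed by `B9Eq315QTower.QkOfU` ∕
`B9Eq326OperatorTower.QkW` (`hα1`, `hreg` at every depth `n : ℕ`) and by `B9Eq315QTowerLipschitzProfile` §4 (`hαg` for `j < k`): ONE display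
`α : ℕ → ℝ`, nonnegative and `≤ 1∕64` everywhere, carrying the `hreg` display at EVERY depth (composed depths `n < k`: the owner's
`ulev_reg_geometric`; junk depths `n ≥ k`, which read `U` itself: leaf-03's `αT` via `ulev_reg_of_pdev`), with `α n ≤ 32(d+1)(d+4)α₀·(L^{−2})^n` for all
`n < k`. [cite: Balaban1985Averaging, Proposition 2 (52)–(54) p.26, (53) p.26, p.25, p.37; Balaban1985BackgroundPropagators, (3.15) p.393, (3.35) p.396] -/
theorem exists_reg_profile_of_pdev :
    ∃ α : ℕ → ℝ, (∀ n, 0 ≤ α n) ∧ (∀ n, α n ≤ 1 / 64) ∧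
      (∀ (n : ℕ) (y : TSite d (towerP L m n)) (κ : Fin d) (r : Fin d → Fin L),
        ‖((Wcx L (perCfg (towerP L m (n + 1)) (UlevOf L m k U n)) (cornerSite L y) κ (boxVec L r) : 𝔸ˣ) : 𝔸) - 1‖ ≤ α n) ∧
      (∀ n < k, α n ≤ 32 * ((d : ℝ) + 1) * ((d : ℝ) + 4) * α₀ * (((L : ℝ) ^ 2)⁻¹) ^ n) := by
  classical
  have hL1 : 1 ≤ L := le_trans (by norm_num) hL
  have hαT := αT_le (d := d) hL1 hα4
  refine ⟨fun n => if n < k then 32 * ((d : ℝ) + 1) * ((d : ℝ) + 4) * α₀ * (((L : ℝ) ^ 2)⁻¹) ^ n else αT d L α₀,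
    fun n => ?_, fun n => ?_, fun n y κ r => ?_, fun n hn => ?_⟩
  · dsimp only
    split_ifs
    · positivity
    · unfold αT; positivity
  · dsimp only
    split_ifs
    · exact (profile_le_αT L hL hα n).trans hαT
    · exact hαT
  · dsimp only
    split_ifs with hn
    · exact (ulev_reg_geometric L m k U hL hG hU hα hα3 hα4 h52 hn y κ r).trans (le_of_eq (by ring))
    · exact ulev_reg_of_pdev L m k U hL hG hU hα hα3 hα4 h52 n y κ r
  · dsimp only
    rw [if_pos hn]

end Literature.MathematicalPhysics.QuantumFieldTheory.Balaban1983to89.B9Eq315QTowerRegularityDisplay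

end
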